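import Mathlib.Analysis.Complex.Basic
import Mathlib.LinearAlgebra.Basis.Defs
import HarnessLib

/-!
# Kuga's lemma in degree one: `Δ = Cas_ρ − Cas_π` on `K`-equivariant `𝔭`-cochains, and
# "Casimir match + unitarity ⇒ every equivariant `1`-cochain is closed and co-closed"

An ABSTRACT, basis-indexed form of the Matsushima–Murakami / Kuga formula for the Laplacian of the
relative Lie algebra complex `C• = Hom_K(Λ•𝔭, H)` in degree `1`
[cite: BorelWallach2000, II §2 (Prop. 2.3, 2.5) and I §5] [cite: MatsushimaMurakami1963, §4–6].

**Setting** (`Kuga.Setup`, `Kuga.Setup.IsLawful`).  `𝔤 = 𝔨 ⊕ 𝔭` is a Cartan decomposition of a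
real reductive Lie algebra with an invariant form `B`, positive on `𝔭` and negative on `𝔨`;
`(x_i)_{i ∈ ι}` is a `B`-orthonormal basis of `𝔭`, `(y_α)_{α ∈ κ}` a `(−B)`-orthonormal basis of
`𝔨`, and `[y_α, x_i] = ∑_j a_{α i j} x_j` with `a_{α i j} = −a_{α j i}` (invariance of `B`), so that
`[x_i, x_j] = −∑_α a_{α i j} y_α`.  On a complex vector space `H` we are given two COMMUTING actions
`π` (of `𝔤` on the automorphic factor) and `ρ` (on the finite-dimensional coefficients), entered
only through the operators `π(x_i), π(y_α), ρ(x_i), ρ(y_α)` and the bracket relations above, with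
EQUAL Casimir operators `∑ π(x_i)² − ∑ π(y_α)² = ∑ ρ(x_i)² − ∑ ρ(y_α)²` (in the application both are
the same scalar: Wigner / the infinitesimal character of a cohomological `π_∞`).  A `1`-cochain is
`η : ι → H` (the values `η(x_i)`) with the infinitesimal `K`-equivariance
`(π + ρ)(y_α) η(x_i) = η([y_α, x_i]) = ∑_j a_{α i j} η(x_j)` (`Setup.IsCochain`).  With
`D_i = π(x_i) + ρ(x_i)` and its formal adjoint `D̃_i = ρ(x_i) − π(x_i)`:
`(dη)_{ij} = D_i η_j − D_j η_i`, `δη = ∑_i D̃_i η_i`, `(Δη)_j = D_j δη + ∑_i D̃_i (dη)_{ij}`.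

**Results.**
* `Kuga.Setup.laplace_eq_zero` — **Kuga's formula in degree one**: `(Δη)_j = (Cas_ρ − Cas_π) η_j`,
  hence `= 0` under the Casimir match; a purely algebraic identity (the `𝔨`-terms cancel by the
  equivariance of `η` and the antisymmetry of `a`).
* `Kuga.Setup.closed_of_posForm`, `Kuga.Setup.coclosed_of_posForm` — if `H` carries a positive
  definite Hermitian form for which `π(x_i)` is skew-adjoint and `ρ(x_i)` self-adjoint (`π` unitary,
  `ρ` with an admissible inner product; only the `𝔭`-directions are used), then
  `0 = ∑_j ⟪(Δη)_j, η_j⟫ = ⟪δη, δη⟫ + ½ ∑_{i,j} ⟪(dη)_{ij}, (dη)_{ij}⟫` forces `dη = 0` and `δη = 0`: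
  every equivariant `1`-cochain is closed and co-closed (harmonic)
  [cite: BorelWallach2000, II Prop. 3.1 and I Cor. 5.4].

This is the archimedean algebra behind the injectivity of cuspidal cohomology in the bottom degree
(Borel) used by the Eichler–Shimura–Harder construction of `GL2CEquivariantPrimitive`.
Everything is proved; no analytic or Lie-theoretic structure is imported (operators and finite sums
only), so the file applies verbatim to `V`-valued cusp forms with the Petersson form.
-/

noncomputable section

open scoped ComplexConjugate BigOperators
open Finset

namespace Literature.NumberTheory.Automorphic

namespace Kuga

variable {H : Type*} [AddCommGroup H] [Module ℂ H]
variable {ι κ : Type*}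

/-! ### Positive definite Hermitian forms (as bare functions) -/

/-- A positive definite Hermitian form on a complex vector space, conjugate-linear in the first
variable (Mathlib's convention), given as a bare function so that concrete pairings (Petersson)
can be fed in without building instances. [folklore] -/
structure IsPosForm (ip : H → H → ℂ) : Prop where
  add_left : ∀ x y z, ip (x + y) z = ip x z + ip y z
  smul_left : ∀ (c : ℂ) (x y : H), ip (c • x) y = conj c * ip x y
  conj_symm : ∀ x y, conj (ip y x) = ip x y
  nonneg : ∀ x, 0 ≤ (ip x x).re
  definite : ∀ x, ip x x = 0 → x = 0

namespace IsPosForm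

variable {ip : H → H → ℂ} (h : IsPosForm ip)
include h

/-- Additivity in the second variable. [folklore] -/
theorem add_right (x y z : H) : ip x (y + z) = ip x y + ip x z := by
  rw [← h.conj_symm, h.add_left, map_add, h.conj_symm, h.conj_symm]

/-- Linearity in the second variable. [folklore] -/
theorem smul_right (c : ℂ) (x y : H) : ip x (c • y) = c * ip x y := by
  rw [← h.conj_symm, h.smul_left, map_mul, Complex.conj_conj, h.conj_symm]

/-- `⟪0, x⟫ = 0`. [folklore] -/
theorem zero_left (x : H) : ip 0 x = 0 := by
  have := h.add_left 0 0 x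
  rw [add_zero] at this
  simpa using this

/-- `⟪x, 0⟫ = 0`. [folklore] -/
theorem zero_right (x : H) : ip x 0 = 0 := by
  rw [← h.conj_symm, h.zero_left, map_zero]

/-- `⟪-x, y⟫ = -⟪x, y⟫`. [folklore] -/
theorem neg_left (x y : H) : ip (-x) y = -ip x y := by
  rw [← neg_one_smul ℂ x, h.smul_left]; simp

/-- `⟪x, -y⟫ = -⟪x, y⟫`. [folklore] -/
theorem neg_right (x y : H) : ip x (-y) = -ip x y := by
  rw [← neg_one_smul ℂ y, h.smul_right]; simp

/-- `⟪x - y, z⟫ = ⟪x, z⟫ - ⟪y, z⟫`. [folklore] -/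
theorem sub_left (x y z : H) : ip (x - y) z = ip x z - ip y z := by
  rw [sub_eq_add_neg, h.add_left, h.neg_left, ← sub_eq_add_neg]

/-- `⟪x, y - z⟫ = ⟪x, y⟫ - ⟪x, z⟫`. [folklore] -/
theorem sub_right (x y z : H) : ip x (y - z) = ip x y - ip x z := by
  rw [sub_eq_add_neg, h.add_right, h.neg_right, ← sub_eq_add_neg]

/-- Finite additivity in the first variable. [folklore] -/
theorem sum_left {σ : Type*} (s : Finset σ) (f : σ → H) (y : H) :
    ip (∑ i ∈ s, f i) y = ∑ i ∈ s, ip (f i) y := by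
  classical
  induction s using Finset.induction_on with
  | empty => simp [h.zero_left]
  | insert a s ha ih => rw [sum_insert ha, sum_insert ha, h.add_left, ih]

/-- Finite additivity in the second variable. [folklore] -/
theorem sum_right {σ : Type*} (s : Finset σ) (x : H) (f : σ → H) :
    ip x (∑ i ∈ s, f i) = ∑ i ∈ s, ip x (f i) := by
  classical
  induction s using Finset.induction_on with
  | empty => simp [h.zero_right]
  | insert a s ha ih => rw [sum_insert ha, sum_insert ha, h.add_right, ih]

/-- `⟪x, x⟫` is real. [folklore] -/
theorem self_im (x : H) : (ip x x).im = 0 := by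
  have e := h.conj_symm x x
  have := congrArg Complex.im e
  rw [Complex.conj_im] at this
  linarith

/-- `re ⟪x, x⟫ = 0` forces `x = 0`. [folklore] -/
theorem eq_zero_of_re_self_eq_zero {x : H} (hx : (ip x x).re = 0) : x = 0 :=
  h.definite x (Complex.ext (by simpa using hx) (by simpa using h.self_im x))

end IsPosForm

/-! ### The setup: two commuting operator families indexed by bases of `𝔭` and `𝔨` -/

variable (H ι κ) in
/-- The data of Kuga's lemma: the operators `π(x_i), π(y_α)` (automorphic factor) and
`ρ(x_i), ρ(y_α)` (coefficient factor) on `H`, and the structure constants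
`[y_α, x_i] = ∑_j a α i j • x_j` of `𝔨` acting on `𝔭`. [cite: BorelWallach2000, II §2.1–2.3] -/
structure Setup where
  /-- `π(x_i)`, `i ∈ ι` indexing an orthonormal basis of `𝔭`. -/
  πp : ι → Module.End ℂ H
  /-- `π(y_α)`, `α ∈ κ` indexing an orthonormal basis of `𝔨` (for `−B`). -/
  πk : κ → Module.End ℂ H
  /-- `ρ(x_i)`. -/
  ρp : ι → Module.End ℂ H
  /-- `ρ(y_α)`. -/
  ρk : κ → Module.End ℂ H
  /-- `[y_α, x_i] = ∑_j a α i j • x_j`. -/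
  a : κ → ι → ι → ℂ

namespace Setup

variable (S : Setup H ι κ)

/-- The total action `D_i = π(x_i) + ρ(x_i)` along `𝔭`. [cite: BorelWallach2000, I §1.2] -/
def D (i : ι) : Module.End ℂ H := S.πp i + S.ρp i

/-- The formal adjoint `D̃_i = ρ(x_i) − π(x_i)` of `D_i` (for `π` unitary, `ρ` admissible).
[cite: BorelWallach2000, II §2.2] -/
def Dt (i : ι) : Module.End ℂ H := S.ρp i - S.πp i

/-- Unfolding `D`. [folklore] -/
@[simp] theorem D_apply (i : ι) (v : H) : S.D i v = S.πp i v + S.ρp i v := rfl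

/-- Unfolding `Dt`. [folklore] -/
@[simp] theorem Dt_apply (i : ι) (v : H) : S.Dt i v = S.ρp i v - S.πp i v := rfl

/-- The differential `(dη)(x_i, x_j) = D_i η_j − D_j η_i` (`[𝔭, 𝔭] ⊆ 𝔨` kills the third term of
the Chevalley–Eilenberg formula in the relative complex). [cite: BorelWallach2000, I §1.2 (2)] -/
def dOne (η : ι → H) (i j : ι) : H := S.D i (η j) - S.D j (η i)

/-- `dη` is alternating. [folklore] -/
theorem dOne_swap (η : ι → H) (i j : ι) : S.dOne η j i = -S.dOne η i j := by
  simp only [dOne, neg_sub]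

variable [Fintype ι] [Fintype κ]

/-- The axioms: antisymmetry of `a` (invariance of `B`), the bracket relations
`[x_i, x_j] = −∑_α a_{αij} y_α` under `π` and under `ρ`, the commutation of `π` with `ρ`, and the
equality of the two Casimir operators `∑ x_i² − ∑ y_α²`. [cite: BorelWallach2000, II §2.3 and 2.5] -/
structure IsLawful : Prop where
  antisymm : ∀ α i j, S.a α i j = -S.a α j i
  bracket_π : ∀ (i j : ι) (v : H),
    S.πp i (S.πp j v) - S.πp j (S.πp i v) = -∑ α, S.a α i j • S.πk α v
  bracket_ρ : ∀ (i j : ι) (v : H),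
    S.ρp i (S.ρp j v) - S.ρp j (S.ρp i v) = -∑ α, S.a α i j • S.ρk α v
  comm_pp : ∀ (i j : ι) (v : H), S.πp i (S.ρp j v) = S.ρp j (S.πp i v)
  comm_kk : ∀ (α β : κ) (v : H), S.πk α (S.ρk β v) = S.ρk β (S.πk α v)
  casimir : ∀ v : H, (∑ i, S.πp i (S.πp i v) - ∑ α, S.πk α (S.πk α v)) =
    ∑ i, S.ρp i (S.ρp i v) - ∑ α, S.ρk α (S.ρk α v)

/-- A `1`-cochain of the relative complex: the values `η i = η(x_i)` of a `K`-equivariant linear map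
`𝔭 → H`, with the infinitesimal equivariance `(π + ρ)(y_α) η(x_i) = η([y_α, x_i])`.
[cite: BorelWallach2000, I §1.2 and §5.1] -/
def IsCochain (η : ι → H) : Prop :=
  ∀ α i, S.πk α (η i) + S.ρk α (η i) = ∑ j, S.a α i j • η j

/-- The codifferential `δη = ∑_i D̃_i η_i` (the adjoint of `d⁰ h = (D_i h)_i`).
[cite: BorelWallach2000, II §2.2] -/
def deltaOne (η : ι → H) : H := ∑ i, S.Dt i (η i)

/-- The Laplacian `(Δη)_j = (d δ η)_j + (δ d η)_j = D_j δη + ∑_i D̃_i (dη)_{ij}` in degree one.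
[cite: BorelWallach2000, II §2.2] -/
def laplaceOne (η : ι → H) (j : ι) : H := S.D j (S.deltaOne η) + ∑ i, S.Dt i (S.dOne η i j)

/-! ### Kuga's formula -/

variable {S}

/-- `[D_j, D̃_i] = ∑_α a_{αij} (ρ − π)(y_α)` (`[π(x), ρ(x')] = 0`, `[x_i, x_j] = −∑ a y`). [folklore] -/
theorem D_Dt_sub (hS : S.IsLawful) (i j : ι) (v : H) :
    S.D j (S.Dt i v) - S.Dt i (S.D j v) = ∑ α, S.a α i j • (S.ρk α v - S.πk α v) := by
  have key : S.D j (S.Dt i v) - S.Dt i (S.D j v) =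
      (S.πp i (S.πp j v) - S.πp j (S.πp i v)) - (S.ρp i (S.ρp j v) - S.ρp j (S.ρp i v)) +
        (S.πp j (S.ρp i v) - S.ρp i (S.πp j v)) + (S.πp i (S.ρp j v) - S.ρp j (S.πp i v)) := by
    simp only [D_apply, Dt_apply, map_sub, map_add]
    abel
  rw [key, hS.bracket_π, hS.bracket_ρ, hS.comm_pp j i v, hS.comm_pp i j v, sub_self, sub_self,
    add_zero, add_zero]
  simp only [smul_sub, Finset.sum_sub_distrib]
  abel

/-- `D̃_i D_i = ρ(x_i)² − π(x_i)²`. [folklore] -/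
theorem Dt_D (hS : S.IsLawful) (i : ι) (v : H) :
    S.Dt i (S.D i v) = S.ρp i (S.ρp i v) - S.πp i (S.πp i v) := by
  simp only [D_apply, Dt_apply, map_add]
  rw [hS.comm_pp i i v]
  abel

omit [Fintype κ] in
/-- The Laplacian regrouped: `(Δη)_j = ∑_i [D_j, D̃_i] η_i + ∑_i D̃_i D_i η_j`. [folklore] -/
theorem laplaceOne_eq_sum (η : ι → H) (j : ι) :
    S.laplaceOne η j =
      ∑ i, (S.D j (S.Dt i (η i)) - S.Dt i (S.D j (η i))) + ∑ i, S.Dt i (S.D i (η j)) := by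
  simp only [laplaceOne, deltaOne, dOne, map_sum, map_sub, Finset.sum_sub_distrib]
  abel

omit [Fintype κ] in
/-- The `𝔨`-action on a cochain: `π(y_α) η_i = ∑_l a_{αil} η_l − ρ(y_α) η_i`. [folklore] -/
theorem IsCochain.πk_apply {η : ι → H} (hη : S.IsCochain η) (α : κ) (i : ι) :
    S.πk α (η i) = ∑ l, S.a α i l • η l - S.ρk α (η i) :=
  eq_sub_of_add_eq (hη α i)

/-- The `𝔨`-Casimir terms on a cochain:
`∑_α (ρ(y_α)² − π(y_α)²) η_j = −∑ a a η + 2 ∑ a ρ(y) η`. [folklore] -/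
theorem IsCochain.sum_k_sq (hS : S.IsLawful) {η : ι → H} (hη : S.IsCochain η) (j : ι) :
    ∑ α, (S.ρk α (S.ρk α (η j)) - S.πk α (S.πk α (η j))) =
      -(∑ α, ∑ l, ∑ m, (S.a α j l * S.a α l m) • η m) +
        2 • ∑ α, ∑ l, S.a α j l • S.ρk α (η l) := by
  have hα : ∀ α, S.ρk α (S.ρk α (η j)) - S.πk α (S.πk α (η j)) =
      -(∑ l, ∑ m, (S.a α j l * S.a α l m) • η m) + 2 • ∑ l, S.a α j l • S.ρk α (η l) := by
    intro α
    rw [two_smul, hη.πk_apply α j, map_sub, map_sum, hS.comm_kk α α]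
    simp only [map_smul, hη.πk_apply α, smul_sub, Finset.sum_sub_distrib, Finset.smul_sum,
      smul_smul, map_sub, map_sum]
    abel
  rw [Finset.sum_congr rfl fun α _ => hα α, Finset.sum_add_distrib, Finset.sum_neg_distrib,
    Finset.smul_sum]

/-- The bracket terms on a cochain:
`∑_{i,α} a_{αij} (ρ − π)(y_α) η_i = 2 ∑ a ρ(y) η − ∑ a a η`. [folklore] -/
theorem IsCochain.sum_bracket {η : ι → H} (hη : S.IsCochain η) (j : ι) :
    ∑ i, ∑ α, S.a α i j • (S.ρk α (η i) - S.πk α (η i)) =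
      2 • ∑ i, ∑ α, S.a α i j • S.ρk α (η i) -
        ∑ i, ∑ α, ∑ l, (S.a α i j * S.a α i l) • η l := by
  have h : ∀ i α, S.a α i j • (S.ρk α (η i) - S.πk α (η i)) =
      2 • (S.a α i j • S.ρk α (η i)) - ∑ l, (S.a α i j * S.a α i l) • η l := by
    intro i α
    rw [hη.πk_apply α i, sub_sub_eq_add_sub, ← two_smul ℕ (S.ρk α (η i)), smul_sub, Finset.smul_sum]
    simp only [smul_smul, smul_comm (S.a α i j) (2 : ℕ)]
  simp only [h, Finset.sum_sub_distrib, Finset.smul_sum]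

/-- Antisymmetry kills the `ρ(y)`-terms. [folklore] -/
theorem sum_a_ρk_antisymm (hS : S.IsLawful) (η : ι → H) (j : ι) :
    ∑ α, ∑ l, S.a α j l • S.ρk α (η l) = -∑ i, ∑ α, S.a α i j • S.ρk α (η i) := by
  rw [Finset.sum_comm, ← Finset.sum_neg_distrib]
  refine Finset.sum_congr rfl fun i _ => ?_
  rw [← Finset.sum_neg_distrib]
  refine Finset.sum_congr rfl fun α _ => ?_
  rw [hS.antisymm α j i, neg_smul]

/-- Antisymmetry kills the `a a`-terms. [folklore] -/
theorem sum_aa_antisymm (hS : S.IsLawful) (η : ι → H) (j : ι) :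
    ∑ α, ∑ l, ∑ m, (S.a α j l * S.a α l m) • η m =
      -∑ i, ∑ α, ∑ l, (S.a α i j * S.a α i l) • η l := by
  rw [Finset.sum_comm (s := (Finset.univ : Finset ι)), ← Finset.sum_neg_distrib]
  refine Finset.sum_congr rfl fun α _ => ?_
  rw [← Finset.sum_neg_distrib]
  refine Finset.sum_congr rfl fun i _ => ?_
  rw [← Finset.sum_neg_distrib]
  refine Finset.sum_congr rfl fun l _ => ?_
  rw [hS.antisymm α j i, neg_mul, neg_smul]

/-- **Kuga's formula in degree one** (under the Casimir match): `Δη = (Cas_ρ − Cas_π) η = 0` for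
every `K`-equivariant `1`-cochain. [cite: BorelWallach2000, II Prop. 2.5 and I §5]
[cite: MatsushimaMurakami1963, §6] -/
theorem laplaceOne_eq_zero (hS : S.IsLawful) {η : ι → H} (hη : S.IsCochain η) (j : ι) :
    S.laplaceOne η j = 0 := by
  rw [laplaceOne_eq_sum]
  simp only [D_Dt_sub hS, Dt_D hS, Finset.sum_sub_distrib]
  -- the `𝔭`-squares: Casimir match turns them into `𝔨`-squares
  have hcas : ∑ i, S.ρp i (S.ρp i (η j)) - ∑ i, S.πp i (S.πp i (η j)) =
      ∑ α, (S.ρk α (S.ρk α (η j)) - S.πk α (S.πk α (η j))) := by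
    rw [Finset.sum_sub_distrib]
    have := hS.casimir (η j)
    rw [sub_eq_sub_iff_sub_eq_sub] at this
    have h' : ∑ i, S.ρp i (S.ρp i (η j)) - ∑ i, S.πp i (S.πp i (η j)) =
        -(∑ i, S.πp i (S.πp i (η j)) - ∑ i, S.ρp i (S.ρp i (η j))) := (neg_sub _ _).symm
    rw [h', this, neg_sub]
  rw [hη.sum_bracket j, hcas, hη.sum_k_sq hS j, sum_a_ρk_antisymm hS η j, sum_aa_antisymm hS η j]
  abel

/-! ### Positivity: closed and co-closed -/

section PosForm

variable {ip : H → H → ℂ}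

omit [Fintype ι] [Fintype κ] in
/-- `⟪x, D_i y⟫ = ⟪D̃_i x, y⟫` for `π(x_i)` skew-adjoint and `ρ(x_i)` self-adjoint. [folklore] -/
theorem ip_D (hip : IsPosForm ip) (hπ : ∀ i x y, ip (S.πp i x) y = -ip x (S.πp i y))
    (hρ : ∀ i x y, ip (S.ρp i x) y = ip x (S.ρp i y)) (i : ι) (x y : H) :
    ip x (S.D i y) = ip (S.Dt i x) y := by
  rw [D_apply, Dt_apply, hip.add_right, hip.sub_left, hρ, hπ]
  ring

omit [Fintype ι] [Fintype κ] in
/-- `⟪x, D̃_i y⟫ = ⟪D_i x, y⟫`. [folklore] -/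
theorem ip_Dt (hip : IsPosForm ip) (hπ : ∀ i x y, ip (S.πp i x) y = -ip x (S.πp i y))
    (hρ : ∀ i x y, ip (S.ρp i x) y = ip x (S.ρp i y)) (i : ι) (x y : H) :
    ip x (S.Dt i y) = ip (S.D i x) y := by
  rw [D_apply, Dt_apply, hip.sub_right, hip.add_left, hρ, hπ]
  ring

omit [Fintype κ] in
/-- **The energy identity**: `2 ∑_j ⟪η_j, (Δη)_j⟫ = 2 ⟪δη, δη⟫ + ∑_{i,j} ⟪(dη)_{ij}, (dη)_{ij}⟫`.
[cite: BorelWallach2000, II §2.2] -/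
theorem energy_identity (hip : IsPosForm ip) (hπ : ∀ i x y, ip (S.πp i x) y = -ip x (S.πp i y))
    (hρ : ∀ i x y, ip (S.ρp i x) y = ip x (S.ρp i y)) (η : ι → H) :
    2 * ∑ j, ip (η j) (S.laplaceOne η j) =
      2 * ip (S.deltaOne η) (S.deltaOne η) + ∑ j, ∑ i, ip (S.dOne η i j) (S.dOne η i j) := by
  -- `∑_j ⟪η_j, D_j δ⟫ = ⟪δ, δ⟫`
  have h1 : ∑ j, ip (η j) (S.D j (S.deltaOne η)) = ip (S.deltaOne η) (S.deltaOne η) := by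
    simp only [ip_D hip hπ hρ]
    rw [← hip.sum_left]
    rfl
  -- `∑_{j,i} ⟪η_j, D̃_i dη_{ij}⟫ = ∑_{j,i} ⟪D_i η_j, dη_{ij}⟫ = ½ ∑ ⟪dη, dη⟫`
  have h2 : ∑ j, ∑ i, ip (S.dOne η i j) (S.dOne η i j) =
      2 * ∑ j, ∑ i, ip (S.D i (η j)) (S.dOne η i j) := by
    have e : ∀ i j, ip (S.dOne η i j) (S.dOne η i j) =
        ip (S.D i (η j)) (S.dOne η i j) - ip (S.D j (η i)) (S.dOne η i j) := by
      intro i j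
      show ip (S.D i (η j) - S.D j (η i)) (S.dOne η i j) = _
      rw [hip.sub_left]
    have e2 : ∑ j, ∑ i, ip (S.D j (η i)) (S.dOne η i j) =
        -∑ j, ∑ i, ip (S.D i (η j)) (S.dOne η i j) := by
      rw [Finset.sum_comm, ← Finset.sum_neg_distrib]
      refine Finset.sum_congr rfl fun j _ => ?_
      rw [← Finset.sum_neg_distrib]
      refine Finset.sum_congr rfl fun i _ => ?_
      rw [dOne_swap, hip.neg_right]
    simp only [e, Finset.sum_sub_distrib]
    rw [e2]
    ring
  have h3 : ∑ j, ip (η j) (S.laplaceOne η j) =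
      ip (S.deltaOne η) (S.deltaOne η) + ∑ j, ∑ i, ip (S.D i (η j)) (S.dOne η i j) := by
    simp only [laplaceOne, hip.add_right, Finset.sum_add_distrib, h1, hip.sum_right,
      ip_Dt hip hπ hρ]
  rw [h3, h2]
  ring

/-- **Every equivariant `1`-cochain is co-closed** (`δη = 0`) when the Casimir operators match,
`π` is unitary and `ρ` admissible. [cite: BorelWallach2000, II Prop. 3.1 and I Cor. 5.4] -/
theorem coclosed_of_posForm (hS : S.IsLawful) (hip : IsPosForm ip)
    (hπ : ∀ i x y, ip (S.πp i x) y = -ip x (S.πp i y))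
    (hρ : ∀ i x y, ip (S.ρp i x) y = ip x (S.ρp i y)) {η : ι → H} (hη : S.IsCochain η) :
    S.deltaOne η = 0 := by
  have hE := energy_identity hip hπ hρ η
  simp only [laplaceOne_eq_zero hS hη, hip.zero_right, Finset.sum_const_zero, mul_zero] at hE
  have hre := congrArg Complex.re hE
  simp only [Complex.zero_re, Complex.add_re, Complex.mul_re, Complex.re_sum] at hre
  norm_num at hre
  -- both summands are non-negative
  have h1 : 0 ≤ (ip (S.deltaOne η) (S.deltaOne η)).re := hip.nonneg _
  have h2 : 0 ≤ ∑ j, ∑ i, (ip (S.dOne η i j) (S.dOne η i j)).re :=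
    Finset.sum_nonneg fun j _ => Finset.sum_nonneg fun i _ => hip.nonneg _
  exact hip.eq_zero_of_re_self_eq_zero (by linarith)

/-- **Every equivariant `1`-cochain is closed** (`dη = 0`, i.e. `D_i η_j = D_j η_i`) when the
Casimir operators match, `π` is unitary and `ρ` admissible.
[cite: BorelWallach2000, II Prop. 3.1 and I Cor. 5.4] -/
theorem closed_of_posForm (hS : S.IsLawful) (hip : IsPosForm ip)
    (hπ : ∀ i x y, ip (S.πp i x) y = -ip x (S.πp i y))
    (hρ : ∀ i x y, ip (S.ρp i x) y = ip x (S.ρp i y)) {η : ι → H} (hη : S.IsCochain η)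
    (i j : ι) : S.D i (η j) = S.D j (η i) := by
  have hE := energy_identity hip hπ hρ η
  simp only [laplaceOne_eq_zero hS hη, hip.zero_right, Finset.sum_const_zero, mul_zero] at hE
  have hre := congrArg Complex.re hE
  simp only [Complex.zero_re, Complex.add_re, Complex.mul_re, Complex.re_sum] at hre
  norm_num at hre
  have h1 : 0 ≤ (ip (S.deltaOne η) (S.deltaOne η)).re := hip.nonneg _
  have hnn : ∀ j i, 0 ≤ (ip (S.dOne η i j) (S.dOne η i j)).re := fun j i => hip.nonneg _
  have h2 : 0 ≤ ∑ j, ∑ i, (ip (S.dOne η i j) (S.dOne η i j)).re :=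
    Finset.sum_nonneg fun j _ => Finset.sum_nonneg fun i _ => hnn j i
  have hsum : ∑ j, ∑ i, (ip (S.dOne η i j) (S.dOne η i j)).re = 0 := by linarith
  have hj := (Finset.sum_eq_zero_iff_of_nonneg fun j _ => Finset.sum_nonneg fun i _ => hnn j i).1
    hsum j (Finset.mem_univ j)
  have hij := (Finset.sum_eq_zero_iff_of_nonneg fun i _ => hnn j i).1 hj i (Finset.mem_univ i)
  exact sub_eq_zero.1 (hip.eq_zero_of_re_self_eq_zero hij)

end PosForm

end Setup

end Kuga

end Literature.NumberTheory.Automorphic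

end
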